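import Literature.IUT.HodgeArakelov.PlusMinusTowerStableCurveBridge
import Literature.IUT.HodgeArakelov.LabelClassesOfCuspsCor24iProofs
import HarnessLib

/-!
# [IUTchII] Def 2.3 (i) «`Π^±_{v▶} := N_{Π^±_v}(Π_{v▶})` … [cf. [IUTchI], Corollary 2.3, (iv)]»: the Π-level `ℍ`-dictionary PRODUCED

S. Mochizuki, *Inter-universal Teichmüller Theory II*, kurims manuscript (Dec. 2020), §2, Def 2.3 (i) p. 67: «we shall write
`Π^±_{v•} := N_{Π^±_v}(Π_{v•}) ⊆ Π^±_{v▶} := N_{Π^±_v}(Π_{v▶}) ⊆ Π^±_v` … Thus, we obtain … equalities `Π^±_{v•} ∩ Π_v = Π_{v•}`,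
`Π^±_{v▶} ∩ Π_v = Π_{v▶}` [cf. [IUTchI], Corollary 2.3, (iv)]»; *Inter-universal Teichmüller Theory I* (May 2020), §2, Cor 2.3 (iii)
p. 47 (`Π^tp_{X,ℍ}`), Cor 2.3 (iv) p. 47 («`Π^tp_{X,ℍ} ⊆ Π^tp_X` is commensurably terminal»)
[cite: Mochizuki2012, II Def 2.3 (i) p.67; I Cor 2.3 (iii)(iv) p.47] (D-0012 claim key, status disputed; every printed statement of
the series below is a HYPOTHESIS named by the tree's L5 declarations — nothing of the series is asserted).  abc-iut cell, seat
abc-iut-w5-d132 (gen 5), row «NV-L6 PiSubgraphDictionary-GENUINE» (abc-iut-w5-d114's L6 inhabitation census v6b: the Prop-package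
`PlusMinusTower.StableCurveAgreement.PiSubgraphDictionary` of abc-iut-L6-t7's B13 v2 had NO discharger at any instance).  PROOF-ONLY
(no `def`, no `structure`, no `instance`).

THE POINT.  `A.PiSubgraphDictionary H` (PlusMinusTowerStableCurveBridge, v2) asks that the agreement `eHat : Π̂^±_v ⥲ Π̂_{X_v}` carry
`Π^±_{v□} := N_{Π^±_v}(Π_{v□})` onto `Π^tp_{X_v,ℍ}` (abc-iut-L5's `piTpXH`, the normaliser of `Δ^tp_{X,ℍ}` in `Π^tp_X`) and be bicontinuous.
For the decomposition subgroup CUT OUT BY THE DATUM, `Π_{v▶} := Π_v ∩ Π^tp_{X_v,ℍ}` — in the tree's coordinates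
`H▶ := incl⁻¹(φ⁻¹(Π^tp_{X,ℍ})) ⊆ P` for the identification `φ : Π^±_v = Π^tp_{X_v}(P) ⥲ Π^tp_X` underlying `eHat` — this IS the
printed sentence «`Π^±_{v▶} := N_{Π^±_v}(Π_{v▶})` … `Π^±_{v▶} ∩ Π_v = Π_{v▶}` [cf. [IUTchI], Corollary 2.3, (iv)]», and its content is the
group-theory lemma

* `IsCommensurablyTerminal.normalizer_inf_eq_of_normal` — **if `K ⊆ G` is commensurably terminal and `N ⊴ G` has finite index, then
  `N_G(K ∩ N) = K`** (folklore; `⊇` by normality, `⊆` because `g(K ∩ N)g⁻¹ = K ∩ N` makes `gKg⁻¹` commensurable with `K`),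

applied with `G = Π^tp_{X_v}`, `K = Π^tp_{X_v,ℍ}` ([IUTchI] Cor 2.3 (iv), `D.Cor23iv` under `D.Cor23Hyp`, BY NAME) and `N = Π_v`
(`Π_v ⊴ Π^±_v` of index `l`: `T.incl.range.Normal`, `T.incl.range.index ≠ 0` — theorems at the genuine settings, abc-iut-L6-t19
`PlusMinusTowerPiVNormal` / `PlusMinusTowerPiVIndex`).  Results (all PROVED, for EVERY tower `W`, agreement `A`, identification `φ`
matched to `eHat` on `Π^±_v`):

* `PlusMinusTower.pmNormalizer_eq_map_normalizer` — `Π^±_{v□} = emb(N_{Π^tp_{X_v}(P)}(incl Π_{v□}))` (the normaliser may be computed in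
  `Π^tp_{X_v}` before embedding into `Π̂^cor_v`);
* `StableCurveAgreement.pmBox_comap_eq` — `Π^±_{v▶} = emb(φ⁻¹ Π^tp_{X,ℍ})`; `box_comap_eq`, **`pmBox_comap_inf_piV`** —
  «`Π^±_{v▶} ∩ Π_v = Π_{v▶}`» (the first clause of abc-iut-L6-t1's `Def23_i_indices` at `H▶`);
* **`StableCurveAgreement.piSubgraphDictionary_comap`** — `A.PiSubgraphDictionary H▶` for every agreement with bicontinuous `eHat`;
  `subgraphDictionary_comap` — hence (with [IUTchI] Cor 2.3 (iii)) the Δ-level dictionary, and `h23v_comap` — hypothesis `h23v` of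
  abc-iut-w4-d012's `cor24_i_of_inputs` at `H▶` from [IUTchI] Cor 2.3 (ii)(iii)(iv)(v) BY NAME.

HONEST LABEL: `H▶` is the decomposition subgroup of `ℍ` in `Π_v` determined by the [IUTchI] §2 datum `D` of `X_v` through the agreement;
identifying it with abc-iut-L6-t1's `SubgraphDecomposition.Ptri` / `Pbullet t` (decomposition groups named on the `Π^tp_{X̲̲_v}` side,
[IUTchII] Prop 2.2 (i)) is the MERGE identification of plan/L6/MERGE-MAP.md (B13/B15 follow-ups), NOT claimed here.  Nothing of the
series is asserted; witnessed ≠ endorsed; no side taken on [IUTchIII] Cor 3.12.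
-/

namespace Literature.AnabelianGeometry.AbsoluteAnabelian

open scoped Pointwise

universe v

variable {G : Type v} [Group G]

/-- **Normaliser of a finite-index normal slice of a commensurably terminal subgroup** ([IUTchI] Cor 2.3 (iv) p. 47 as used in
[IUTchII] Def 2.3 (i) p. 67, «`Π^±_{v▶} ∩ Π_v = Π_{v▶}` [cf. [IUTchI], Corollary 2.3, (iv)]»): if `K ⊆ G` is commensurably terminal
and `N ⊴ G` is normal of finite index, then `N_G(K ∩ N) = K`.  PROVED (folklore group theory). [cite: MochizukiAbsAnab2004, Def 0.1 (iii) p.4] -/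
theorem IsCommensurablyTerminal.normalizer_inf_eq_of_normal {K N : Subgroup G} (hK : IsCommensurablyTerminal K)
    [hN : N.Normal] (hNi : N.index ≠ 0) :
    Subgroup.normalizer ((K ⊓ N : Subgroup G) : Set G) = K := by
  apply le_antisymm
  · intro g hg
    rw [← hK.commensurator_eq, Subgroup.Commensurable.commensurator_mem_iff]
    have hg' := Subgroup.mem_normalizer_iff''.mp hg
    -- `g (K ∩ N) g⁻¹ = K ∩ N`
    have hfix : ConjAct.toConjAct g • (K ⊓ N) = K ⊓ N := by
      ext x
      rw [Subgroup.mem_pointwise_smul_iff_inv_smul_mem, ← map_inv, ConjAct.smul_def,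
        ConjAct.ofConjAct_toConjAct, inv_inv]
      exact (hg' x).symm
    have hNfix : ConjAct.toConjAct g • N = N := hN.conjAct _
    -- `K ∩ N ⊆ g K g⁻¹`
    have hKN : K ⊓ N ≤ ConjAct.toConjAct g • K := by
      intro x hx
      rw [← hfix] at hx
      rw [Subgroup.mem_pointwise_smul_iff_inv_smul_mem] at hx ⊢
      exact hx.1
    refine ⟨?_, ?_⟩
    · -- `[K : gKg⁻¹ ∩ K] ≤ [K : K ∩ N] ≤ [G : N] < ∞`
      intro h0
      have h1 : (K ⊓ N).relIndex K = 0 := Subgroup.relIndex_eq_zero_of_le_left hKN h0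
      rw [Subgroup.inf_relIndex_left] at h1
      exact hNi (Subgroup.index_eq_zero_of_relIndex_eq_zero h1)
    · -- `[gKg⁻¹ : K ∩ gKg⁻¹] ≤ [gKg⁻¹ : gKg⁻¹ ∩ N] ≤ [G : N] < ∞`, as `K ∩ N = g(K ∩ N)g⁻¹ = gKg⁻¹ ∩ N`
      intro h0
      have h1 : (K ⊓ N).relIndex (ConjAct.toConjAct g • K) = 0 :=
        Subgroup.relIndex_eq_zero_of_le_left inf_le_left h0
      rw [← hfix, Subgroup.smul_inf, hNfix, Subgroup.inf_relIndex_left] at h1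
      exact hNi (Subgroup.index_eq_zero_of_relIndex_eq_zero h1)
  · intro k hk
    rw [Subgroup.mem_normalizer_iff]
    intro x
    constructor
    · intro hx
      exact ⟨K.mul_mem (K.mul_mem hk hx.1) (K.inv_mem hk), hN.conj_mem _ hx.2 _⟩
    · intro hx
      have h1 : k⁻¹ * (k * x * k⁻¹) * k⁻¹⁻¹ ∈ K ⊓ N :=
        ⟨K.mul_mem (K.mul_mem (K.inv_mem hk) hx.1) (K.inv_mem (K.inv_mem hk)), hN.conj_mem _ hx.2 _⟩
      simpa only [inv_inv, mul_assoc, inv_mul_cancel_left, inv_mul_cancel, mul_one] using h1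

/-- The same with the intersection written `N ∩ K`. PROVED. [cite: MochizukiAbsAnab2004, Def 0.1 (iii) p.4] -/
theorem IsCommensurablyTerminal.normalizer_normal_inf_eq {K N : Subgroup G} (hK : IsCommensurablyTerminal K)
    [N.Normal] (hNi : N.index ≠ 0) :
    Subgroup.normalizer ((N ⊓ K : Subgroup G) : Set G) = K := by
  rw [inf_comm]; exact hK.normalizer_inf_eq_of_normal hNi

end Literature.AnabelianGeometry.AbsoluteAnabelian

namespace Literature.IUT.HodgeArakelov

open Literature.IUT.HodgeTheaters
open Literature.AnabelianGeometry.AbsoluteAnabelian (IsCommensurablyTerminal)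
open scoped Pointwise

universe u

variable {S : BadPlaceSetting.{u}} {P : TopGroup.{u}} {T : TemperedCoverings S P}

namespace PlusMinusTower

variable (W : PlusMinusTower T)

/-- **IUTchII:Def2.3(i)** (kurims p.67) `Π_{v□} = emb(incl Π_{v□})`: the two-step image. [claim: Mochizuki2012, status: disputed] -/
theorem box_eq_map_map (H : Subgroup P) : W.box H = (H.map T.incl).map W.emb :=
  (H.map_map _ _).symm

/-- **IUTchII:Def2.3(i)** (kurims p.67) `Π^±_{v□} := N_{Π^±_v}(Π_{v□})` computed INSIDE `Π^tp_{X_v}(P)` and then embedded: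
`Π^±_{v□} = emb(N_{Π^tp_{X_v}(P)}(incl Π_{v□}))` (`emb` is injective with image `Π^±_v`).  PROVED, for every tower and every `Π_{v□} ⊆ Π_v`.
[claim: Mochizuki2012, status: disputed] -/
theorem pmNormalizer_eq_map_normalizer (H : Subgroup P) :
    W.pmNormalizer H =
      (Subgroup.normalizer ((H.map T.incl : Subgroup T.Xplain) : Set T.Xplain)).map W.emb := by
  ext x
  rw [W.mem_pmNormalizer_iff H, W.box_eq_map_map H]
  constructor
  · rintro ⟨⟨y, rfl⟩, hn⟩
    refine ⟨y, ?_, rfl⟩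
    rw [SetLike.mem_coe, Subgroup.mem_normalizer_iff]
    intro n
    rw [← Subgroup.mem_map_iff_mem W.emb_injective, ← Subgroup.mem_map_iff_mem W.emb_injective (x := y * n * y⁻¹),
      map_mul, map_mul, map_inv]
    exact hn (W.emb n)
  · rintro ⟨y, hy, rfl⟩
    rw [SetLike.mem_coe, Subgroup.mem_normalizer_iff] at hy
    refine ⟨⟨y, rfl⟩, fun h => ?_⟩
    constructor
    · rintro ⟨n, hn, rfl⟩
      rw [← map_mul, ← map_inv, ← map_mul, Subgroup.mem_map_iff_mem W.emb_injective]
      exact (hy n).mp hn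
    · rintro ⟨m, hm, hmh⟩
      -- `h = emb(y⁻¹ m y)`
      have hh : h = W.emb (y⁻¹ * m * y) := by
        rw [map_mul, map_mul, map_inv, hmh]; group
      refine ⟨y⁻¹ * m * y, (hy (y⁻¹ * m * y)).mpr ?_, hh.symm⟩
      have : y * (y⁻¹ * m * y) * y⁻¹ = m := by group
      rwa [this]

namespace StableCurveAgreement

variable {W} {C : CuspidalInertiaData W} {D : StableCurveTemperedData.{u}}

/-- **IUTchI:Cor2.3(iv)** (kurims p.47) **«`Π^±_{v▶} = Π^tp_{X_v,ℍ}`» in `Π^tp_{X_v}(P)`**: for `H▶ := incl⁻¹(φ⁻¹ Π^tp_{X,ℍ})` (`Π_{v▶} := Π_v ∩ Π^tp_{X_v,ℍ}`),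
`N_{Π^tp_{X_v}(P)}(incl H▶) = φ⁻¹(Π^tp_{X,ℍ})` — from [IUTchI] Cor 2.3 (iv) (`D.Cor23iv`, BY NAME, under `D.Cor23Hyp`) and `Π_v ⊴ Π^±_v` of
finite index, via `IsCommensurablyTerminal.normalizer_inf_eq_of_normal` transported along `φ`.  PROVED. [claim: Mochizuki2012, status: disputed] -/
theorem normalizer_map_incl_comap_eq (φ : T.Xplain ≃* D.PiTp) (hN : T.incl.range.Normal)
    (hI : T.incl.range.index ≠ 0) (hHyp : D.Cor23Hyp) (h23iv : D.Cor23iv) :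
    Subgroup.normalizer
        ((((D.piTpXH.comap φ.toMonoidHom).comap T.incl).map T.incl : Subgroup T.Xplain) : Set T.Xplain) =
      D.piTpXH.comap φ.toMonoidHom := by
  have h1 : ((D.piTpXH.comap φ.toMonoidHom).comap T.incl).map T.incl =
      D.piTpXH.comap φ.toMonoidHom ⊓ T.incl.range := by
    rw [Subgroup.map_comap_eq, inf_comm]
  -- push everything forward along `φ`
  haveI hNφ : (T.incl.range.map φ.toMonoidHom).Normal := Subgroup.Normal.map hN _ φ.surjective
  have hIφ : (T.incl.range.map φ.toMonoidHom).index ≠ 0 := by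
    rwa [MulEquiv.toMonoidHom_eq_coe, Subgroup.index_map_equiv]
  have hK : IsCommensurablyTerminal D.piTpXH := h23iv.tp hHyp
  have hA := hK.normalizer_inf_eq_of_normal (N := T.incl.range.map φ.toMonoidHom) hIφ
  have h3 : (((D.piTpXH.comap φ.toMonoidHom).comap T.incl).map T.incl).map φ.toMonoidHom =
      D.piTpXH ⊓ T.incl.range.map φ.toMonoidHom := by
    rw [h1, Subgroup.map_inf_eq _ _ _ φ.injective, Subgroup.map_comap_eq_self_of_surjective φ.surjective]
  have h4 := Subgroup.map_equiv_normalizer_eq (((D.piTpXH.comap φ.toMonoidHom).comap T.incl).map T.incl) φ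
  rw [h3, hA] at h4
  have h5 := congrArg (Subgroup.comap φ.toMonoidHom) h4
  rwa [Subgroup.comap_map_eq_self_of_injective φ.injective] at h5

/-- **IUTchII:Def2.3(i)** (kurims p.67) «`Π_{v▶}`»: `Π_{v▶} = emb(φ⁻¹ Π^tp_{X,ℍ} ∩ incl Π_v)` for `H▶ := incl⁻¹(φ⁻¹ Π^tp_{X,ℍ})`. PROVED.
[claim: Mochizuki2012, status: disputed] -/
theorem box_comap_eq (φ : T.Xplain ≃* D.PiTp) :
    W.box ((D.piTpXH.comap φ.toMonoidHom).comap T.incl) =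
      (D.piTpXH.comap φ.toMonoidHom ⊓ T.incl.range).map W.emb := by
  rw [W.box_eq_map_map, Subgroup.map_comap_eq, inf_comm]

/-- **IUTchII:Def2.3(i)** (kurims p.67) **«`Π^±_{v▶} := N_{Π^±_v}(Π_{v▶})` IS `Π^tp_{X_v,ℍ}`**: `Π^±_{v▶} = emb(φ⁻¹ Π^tp_{X,ℍ})` for `H▶`, from [IUTchI]
Cor 2.3 (iv) BY NAME and `Π_v ⊴ Π^±_v` of finite index.  PROVED. [claim: Mochizuki2012, status: disputed] -/
theorem pmBox_comap_eq (φ : T.Xplain ≃* D.PiTp) (hN : T.incl.range.Normal) (hI : T.incl.range.index ≠ 0)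
    (hHyp : D.Cor23Hyp) (h23iv : D.Cor23iv) :
    W.pmBox ((D.piTpXH.comap φ.toMonoidHom).comap T.incl) = (D.piTpXH.comap φ.toMonoidHom).map W.emb := by
  change W.pmNormalizer _ = _
  rw [W.pmNormalizer_eq_map_normalizer, normalizer_map_incl_comap_eq φ hN hI hHyp h23iv]

/-- **IUTchII:Def2.3(i)** (kurims p.67) **«`Π^±_{v▶} ∩ Π_v = Π_{v▶}` [cf. [IUTchI], Corollary 2.3, (iv)]»** at `H▶` — the first clause of
abc-iut-L6-t1's `Def23_i_indices`, PROVED from [IUTchI] Cor 2.3 (iv) BY NAME. [claim: Mochizuki2012, status: disputed] -/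
theorem pmBox_comap_inf_piV (φ : T.Xplain ≃* D.PiTp) (hN : T.incl.range.Normal) (hI : T.incl.range.index ≠ 0)
    (hHyp : D.Cor23Hyp) (h23iv : D.Cor23iv) :
    W.pmBox ((D.piTpXH.comap φ.toMonoidHom).comap T.incl) ⊓ W.piV =
      W.box ((D.piTpXH.comap φ.toMonoidHom).comap T.incl) := by
  rw [pmBox_comap_eq φ hN hI hHyp h23iv, box_comap_eq,
    show W.piV = T.incl.range.map W.emb from (MonoidHom.range_comp _ _),
    ← Subgroup.map_inf_eq _ _ _ W.emb_injective]

/-- **IUTchII:Def2.3(i)** (kurims p.67) **THE Π-LEVEL `ℍ`-DICTIONARY PRODUCED.**  For every agreement `A : StableCurveAgreement W C D` whose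
`eHat : Π̂^±_v ⥲ Π̂_{X_v}` is bicontinuous and restricts on `Π^±_v` to an identification `φ : Π^tp_{X_v}(P) ⥲ Π^tp_X` (`eHat ∘ emb = ιX ∘ φ`
— exactly what the genuine agreements of p430970 / p433029 export), with `Π_v ⊴ Π^±_v` of finite index and [IUTchI] Cor 2.3 (iv)
(`D.Cor23iv` under `D.Cor23Hyp`) BY NAME: `A.PiSubgraphDictionary H▶` for `H▶ := incl⁻¹(φ⁻¹ Π^tp_{X,ℍ})` — `eHat` carries
`Π^±_{v▶} = N_{Π^±_v}(Π_{v▶})` onto `Π^tp_{X_v,ℍ} ↪ Π̂_{X_v}`.  PROVED. [claim: Mochizuki2012, status: disputed] -/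
theorem piSubgraphDictionary_comap (A : StableCurveAgreement W C D) (hA : IsHomeomorph A.eHat)
    (φ : T.Xplain ≃* D.PiTp)
    (hφ : ∀ x : T.Xplain, A.eHat ⟨W.emb x, W.emb_le_pmHat ⟨x, rfl⟩⟩ = D.ιX (φ x))
    (hN : T.incl.range.Normal) (hI : T.incl.range.index ≠ 0) (hHyp : D.Cor23Hyp) (h23iv : D.Cor23iv) :
    A.PiSubgraphDictionary ((D.piTpXH.comap φ.toMonoidHom).comap T.incl) := by
  refine ⟨?_, hA⟩
  have h5 := pmBox_comap_eq (W := W) φ hN hI hHyp h23iv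
  ext y
  constructor
  · rintro ⟨q, hq, rfl⟩
    rw [SetLike.mem_coe, Subgroup.mem_subgroupOf, h5] at hq
    obtain ⟨x, hx, hxq⟩ := hq
    have hq' : q = ⟨W.emb x, W.emb_le_pmHat ⟨x, rfl⟩⟩ := Subtype.ext hxq.symm
    refine ⟨φ x, hx, ?_⟩
    rw [MulEquiv.coe_toMonoidHom, hq', hφ]
  · rintro ⟨z, hz, rfl⟩
    refine ⟨⟨W.emb (φ.symm z), W.emb_le_pmHat ⟨φ.symm z, rfl⟩⟩, ?_, ?_⟩
    · rw [SetLike.mem_coe, Subgroup.mem_subgroupOf, h5]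
      refine ⟨φ.symm z, ?_, rfl⟩
      rw [SetLike.mem_coe, Subgroup.mem_comap, MulEquiv.coe_toMonoidHom, MulEquiv.apply_symm_apply]
      exact hz
    · rw [MulEquiv.coe_toMonoidHom, hφ, MulEquiv.apply_symm_apply]

/-- **IUTchI:Cor2.3(iii)** (kurims p.47) Hence (with [IUTchI] Cor 2.3 (iii) BY NAME) the Δ-level dictionary `A.SubgraphDictionary H▶`
(`Δ^±_{v▶} = Δ^tp_{X,ℍ}`). PROVED. [claim: Mochizuki2012, status: disputed] -/
theorem subgraphDictionary_comap (A : StableCurveAgreement W C D) (hA : IsHomeomorph A.eHat)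
    (φ : T.Xplain ≃* D.PiTp)
    (hφ : ∀ x : T.Xplain, A.eHat ⟨W.emb x, W.emb_le_pmHat ⟨x, rfl⟩⟩ = D.ιX (φ x))
    (hN : T.incl.range.Normal) (hI : T.incl.range.index ≠ 0) (hHyp : D.Cor23Hyp) (h23iii : D.Cor23iii)
    (h23iv : D.Cor23iv) :
    A.SubgraphDictionary ((D.piTpXH.comap φ.toMonoidHom).comap T.incl) :=
  SubgraphDictionary.of_pi A (A.piSubgraphDictionary_comap hA φ hφ hN hI hHyp h23iv) hHyp h23iii

/-- **IUTchII:Cor2.4(i)** (kurims pp.70–71) Hypothesis `h23v` of abc-iut-w4-d012's `cor24_i_of_inputs` AT `H▶`, from [IUTchI] Cor 2.3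
(ii)(iii)(iv)(v) BY NAME along an agreement with bicontinuous `eHat`: for `γ' ∈ Δ^±_v`, `γ' ∈` closure of `Δ^±_{v▶}` ⟹ `γ' ∈ Δ^±_{v▶}`.
PROVED. [claim: Mochizuki2012, status: disputed] -/
theorem h23v_comap (A : StableCurveAgreement W C D) (hA : IsHomeomorph A.eHat)
    (φ : T.Xplain ≃* D.PiTp)
    (hφ : ∀ x : T.Xplain, A.eHat ⟨W.emb x, W.emb_le_pmHat ⟨x, rfl⟩⟩ = D.ιX (φ x))
    (hN : T.incl.range.Normal) (hI : T.incl.range.index ≠ 0) (hHyp : D.Cor23Hyp) (h23ii : D.Cor23ii)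
    (h23iii : D.Cor23iii) (h23iv : D.Cor23iv) (h23vD : D.Cor23v) :
    ∀ γ' : W.Corhat, γ' ∈ W.piPM ⊓ W.aug.ker →
      γ' ∈ closure (W.deltaPmBox ((D.piTpXH.comap φ.toMonoidHom).comap T.incl) : Set W.Corhat) →
        γ' ∈ W.deltaPmBox ((D.piTpXH.comap φ.toMonoidHom).comap T.incl) :=
  A.h23v (A.subgraphDictionary_comap hA φ hφ hN hI hHyp h23iii h23iv) h23ii h23vD

end StableCurveAgreement

end PlusMinusTower

end Literature.IUT.HodgeArakelov
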